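import Literature.AnabelianGeometry.AbsoluteAnabelian.ArchimedeanUnivCover
import Mathlib.Analysis.Complex.CoveringMap
import Mathlib.Analysis.Convex.Contractible
import HarnessLib

/-!
# [AbsTopIII] §4, Def 4.1 (i): the realised `k~ ↠ k^×` of a CAF IS a universal covering (kernel check)

Mochizuki, *Topics in Absolute Anabelian Geometry III*, Definition 4.1 (i) p. 101 of the author's
kurims manuscript (lit key `paper:url-5493eb38cbb7`; bib key `MochizukiAbsTopIII2015`): "`k~ ↠ k^×`
… the universal covering of `k^×` — uniquely determined, up to unique isomorphism, as a pointed
topological space … admits a natural topological group structure".  The tree REALISES `k~` as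
`(k, +)` with covering map `univCover k := NormedSpace.exp` (`ArchimedeanLogFrobenius.lean`).
PROOF-ONLY file (abc-iut cell, seat abc-iut-w5-d210; node `AbsTopIII:Def4.1(i)`, realisation check):
for a CAF `k` the realisation has the two printed properties that make it "the universal covering":

* `IsCAF.isCoveringMapOn_univCover` — `univCover k : k → k` is a covering map over `k^× = k ∖ {0}`
  (Mathlib `Complex.isCoveringMapOn_exp` transported along a bicontinuous `e : k ≃+* ℂ`, using
  `IsCAF.univCover_eq : univCover k = e⁻¹ ∘ exp ∘ e` of `ArchimedeanUnivCover.lean`);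
* `IsCAF.contractibleSpace` / `IsCAF.simplyConnectedSpace` — the total space `k~ = k` is contractible,
  hence simply connected (so the covering is universal);
together with `IsCAF.continuous_univCover` and the pointing `univCover_zero` (already landed).

Classical; nothing here bears on [IUTchIII] Cor. 3.12 or takes a side.
-/

namespace Literature.AnabelianGeometry.AbsoluteAnabelian

open _root_.Complex _root_.Topology

universe u

noncomputable section

namespace IsCAF

variable {k : Type u} [NormedField k]

/-- `exp_k` is continuous on a CAF. [cite: MochizukiAbsTopIII2015, Definition 4.1 (i) p.101] -/
theorem continuous_univCover [CharZero k] (hk : IsCAF k) : Continuous (univCover k) := by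
  obtain ⟨e, he, he'⟩ := hk.exists_equiv
  have : univCover k = fun x => e.symm (Complex.exp (e x)) := funext (univCover_eq e he')
  rw [this]
  exact he'.comp (Complex.continuous_exp.comp he)

/-- **`k~ ↠ k^×` is a covering map** over `k^× = k ∖ {0}`: the realised `univCover k = exp_k` of a
CAF is a covering map onto the nonzero elements (transport of `Complex.isCoveringMapOn_exp` along a
bicontinuous `k ≃+* ℂ`). [cite: MochizukiAbsTopIII2015, Definition 4.1 (i) p.101] -/
theorem isCoveringMapOn_univCover [CharZero k] (hk : IsCAF k) :
    IsCoveringMapOn (univCover k) ({0}ᶜ : Set k) := by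
  obtain ⟨e, he, he'⟩ := hk.exists_equiv
  let eH : k ≃ₜ ℂ := { e.toEquiv with continuous_toFun := he, continuous_invFun := he' }
  have eH_apply : ∀ x, eH x = e x := fun _ => rfl
  have eH_symm_apply : ∀ z, eH.symm z = e.symm z := fun _ => rfl
  have h1 : IsCoveringMapOn (Complex.exp ∘ eH) ({0}ᶜ : Set ℂ) :=
    Complex.isCoveringMapOn_exp.comp_homeomorph eH
  have h2 : IsCoveringMapOn (eH.symm ∘ (Complex.exp ∘ eH)) (eH.symm.symm ⁻¹' ({0}ᶜ : Set ℂ)) :=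
    h1.homeomorph_comp eH.symm
  have hset : eH.symm.symm ⁻¹' ({0}ᶜ : Set ℂ) = ({0}ᶜ : Set k) := by
    ext x
    simp only [Homeomorph.symm_symm, Set.preimage_compl, Set.mem_compl_iff, Set.mem_preimage,
      Set.mem_singleton_iff, eH_apply, map_eq_zero_iff e e.injective]
  have hfun : eH.symm ∘ (Complex.exp ∘ eH) = univCover k := by
    funext x
    simp only [Function.comp_apply, eH_symm_apply, eH_apply]
    exact (univCover_eq e he' x).symm
  rw [hset, hfun] at h2
  exact h2

/-- The same packaged as a covering map in Mathlib's sense: the restriction of `exp_k` over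
`k^× = k ∖ {0}` (domain: the preimage, which is all of `k~` since `exp_k` never vanishes).
[cite: MochizukiAbsTopIII2015, Definition 4.1 (i) p.101] -/
theorem isCoveringMap_univCover_restrictPreimage [CharZero k] (hk : IsCAF k) :
    IsCoveringMap (({0}ᶜ : Set k).restrictPreimage (univCover k)) :=
  (isCoveringMapOn_univCover hk).isCoveringMap_restrictPreimage

/-- The domain of that restriction is everything: `exp_k ⁻¹' (k ∖ {0}) = k~`.
[cite: MochizukiAbsTopIII2015, Definition 4.1 (i) p.101] -/
theorem univCover_preimage_compl_zero [CharZero k] (hk : IsCAF k) :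
    univCover k ⁻¹' ({0}ᶜ : Set k) = Set.univ :=
  Set.eq_univ_of_forall fun x => univCover_ne_zero hk x

/-- **The total space `k~ = (k, +)` of a CAF is contractible** (it is homeomorphic to `ℂ`, a convex
set), … [cite: MochizukiAbsTopIII2015, Definition 4.1 (i) p.101] -/
theorem contractibleSpace (hk : IsCAF k) : ContractibleSpace k := by
  obtain ⟨e, he, he'⟩ := hk.exists_equiv
  have hC : ContractibleSpace (Set.univ : Set ℂ) := (convex_univ).contractibleSpace Set.univ_nonempty
  have hC' : ContractibleSpace ℂ := (Homeomorph.Set.univ ℂ).symm.contractibleSpace_iff.mpr hC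
  let eH : k ≃ₜ ℂ := { e.toEquiv with continuous_toFun := he, continuous_invFun := he' }
  exact eH.contractibleSpace_iff.mpr hC'

/-- … hence simply connected: the covering `exp_k : k~ ↠ k^×` is a UNIVERSAL covering.
[cite: MochizukiAbsTopIII2015, Definition 4.1 (i) p.101] -/
theorem simplyConnectedSpace (hk : IsCAF k) : SimplyConnectedSpace k := by
  haveI := contractibleSpace hk
  infer_instance

end IsCAF

end

end Literature.AnabelianGeometry.AbsoluteAnabelian
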